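import Literature.MathematicalPhysics.QuantumFieldTheory.Balaban1983to89.B1Eq324BenfattoKernelSect5ClassUpperStep
import Literature.MathematicalPhysics.QuantumFieldTheory.Balaban1983to89.B1Eq324BenfattoKernelSect5PavementChain
import HarnessLib

/-!
# `Balaban1983to89.B1Eq324BenfattoKernelSect5ClassUpperStepFrame` — [BenfattoEtAl1978] §5 p. 159 «a new pavement displaced», (5.36): ONE UPPER PAVEMENT STEP
# OF THE CLASS ROAD FROM THE CLASS ROWS, IN A DRIFTING FRAME — the step-`k` hypotheses of the class UPPER pavement chain (`hbox`, set-integral currency,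
# conditioning `C_k + τ_k`) and of (4.6)'s collection of errors (`hE`, closed) at the frame-`σ` class member for the translated datum AND the translated
# conditioning set, from the frame-0 class rows (the mirror of `…KernelSect5ClassLowerStepFrame`)

statement-level skeleton of published theorems with citation tags; proofs where landed; nothing here is a claim about the
Yang–Mills mass gap

WHY THIS MODULE (cell `pub-ymgap`, seat `dag-n08-c` gen 32; node N08 [Balaban1985UV3]; the [BenfattoEtAl1978] source chain behind the (α)-row `h324`;
the (4.6) side of the ASSEMBLY layer over seat n08-d's class upper chain `…KernelSect5PavementChainUpper.upperPavementChainCond(_le_exp)` (p619737)).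
The chain's step `k` lives at the class member in frame `σ_{k+1}` — `(Λ − σ, A(·+σ,·+σ))` with class kernel `K(·+σ,·+σ)`
(`…KernelSect5Iteration.kernel_translate`) — for the translated datum `(A_k(·−τ_k), J_k + τ_k ⊆ I_k + τ_k, b_k)` and the translated conditioning set
`C_k + τ_k` (S8b's `hrecC`); its per-box hypothesis `hbox` is ALREADY in set-integral currency (centre `condMean K(·+σ,·+σ) ((C_k+τ_k) ∪ Γ₁) ξ`), and my
`…KernelSect5CollectErrors.le_exp_cumulantSum_add_of_chain` (§3, v1.1) wants per step the UPPER identification (hE) under `𝒩(0, K(·+σ,·+σ))`.  This file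
transports `…KernelSect5ClassUpperStep.exists_upper_step_of_classRows` (standard position) to that frame member, exactly as `…ClassLowerStepFrame` does on
the (4.7) side: the class constants `(γ_A, θ, J_c, V₂, M₂, V₄)` are FRAME INVARIANT (n08-d `…KernelSect5PavementChain` §1 `submatrix_translate_row_le` /
`translate_row_le` at the translation-invariant Euclidean weights, `…KernelSect5Iteration.submatrix_translate_symm/_coercive`), the datum rows transport
by `…Sect5PavementChain.coefSupportedIn_frame` / `abs_shiftCoef_neg_le`, and the conditioning rows (`C + τ ⊆ Λ − σ`, `C + τ` missing the parts, `|·−·|₂`-far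
from the boxes) are displayed AT THE FRAME — so the output is LITERALLY the step-`k` `hbox` of `upperPavementChainCond` and the step-`k` `hE` of
`le_exp_cumulantSum_add_of_chain` at `σ := σ_{k+1}`, `τ := τ_k`, `(J, I, A, b, C) := (J_k, I_k, A_k, b_k, C_k)` (no currency bridge needed; the part
kernels stay in the standard `shrink L m w` currency — S8b's `shrink L m w − (C+τ)` row is served from it by n08-d's
`…PavementChainUpper.partKernel_row_sdiff_of_disjoint` in the knit, since `C + τ` misses the parts).

WHAT IS PROVED (theorems only; no definition, no named fact, no `sorry`; axioms standard).
* ★★★ `exists_upper_step_of_classRows_frame` — ∃ `u`: (hbox, upper, set-integral currency, frame `σ`, conditioning `(C+τ) ∪ Γ₁`) ∧ (hE, upper, closed,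
  under `𝒩(0, K(·+σ,·+σ))`), from the frame-0 class rows, the frame containments of the pavement and of `C + τ`, the definitional part-kernel row of the
  frame member and the displayed constant ties of `exists_upper_step_of_classRows` (with ref-G READ347 NOTE-1: `v ≤ w` displayed, so the deep row decays).

HONEST SCOPE / NOT HERE.  The chain over the steps, the terminal conditioned volume and the ledger are the knit (`…KernelSect5UpperAssembly`, next);
the class is OURS ([Balaban1985BackgroundPropagators] Sect. E at temperature zero), not print's `P̂₀`; one self-located piece of an UNCOMMISSIONED port
(plan g81 (II), START-LIST v11 §n08) — nothing chained; no generalised Basic Lemma is stated; nothing of [Balaban1985UV3] is asserted; count-neutral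
for N08; nothing about d = 4, the continuum, OS axioms, a mass gap or the Clay problem.
-/

noncomputable section

open MeasureTheory ProbabilityTheory Finset Matrix
open scoped BigOperators Nat NNReal

namespace Literature.MathematicalPhysics.QuantumFieldTheory.Balaban1983to89.B1Eq324BenfattoKernelSect5ClassUpperStepFrame

open _root_.MeasureTheory _root_.ProbabilityTheory
open Literature.Probability.LatticeModels (setPartitions)
open Literature.MathematicalPhysics.QuantumFieldTheory
open Literature.MathematicalPhysics.QuantumFieldTheory.Balaban1983to89.B1Eq324BenfattoLemma
open Literature.MathematicalPhysics.QuantumFieldTheory.Balaban1983to89.B1Eq324BenfattoSect5Boxes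
open Literature.MathematicalPhysics.QuantumFieldTheory.Balaban1983to89.B1Eq324BenfattoSect5Eq511
open Literature.MathematicalPhysics.QuantumFieldTheory.Balaban1983to89.B1Eq324BenfattoSect5Eq524
open Literature.MathematicalPhysics.QuantumFieldTheory.Balaban1983to89.B1Eq324BenfattoSect5Eq534
open Literature.MathematicalPhysics.QuantumFieldTheory.Balaban1983to89.B1Eq324BenfattoSect5Eq515
open Literature.MathematicalPhysics.QuantumFieldTheory.Balaban1983to89.B1Eq324BenfattoSect5Iteration (restrictCoef shiftCoef)
open Literature.MathematicalPhysics.QuantumFieldTheory.Balaban1983to89.B1Eq324BenfattoKernelSect5ClassUpperStep (exists_upper_step_of_classRows)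
open Literature.MathematicalPhysics.QuantumFieldTheory.Balaban1983to89.B1Eq324BenfattoKernelSect5Iteration
  (mem_image_sub_iff kernel_translate submatrix_translate_symm submatrix_translate_coercive)
open Literature.MathematicalPhysics.QuantumFieldTheory.Balaban1983to89.B1Eq324BenfattoKernelSect5PavementChain
  (l2_translate submatrix_translate_row_le translate_row_le)
open Literature.MathematicalPhysics.QuantumFieldTheory.Balaban1983to89.B1Eq324BenfattoSect5PavementChain (coefSupportedIn_frame abs_shiftCoef_neg_le)
open Literature.MathematicalPhysics.QuantumFieldTheory.Balaban1983to89.B1Eq324GaussianMomentLeaf (momentConst)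

variable {d : ℕ}

section Frame

variable {Λ : Finset (B1Eq324BenfattoLemma.Site d)} {A : Matrix Λ Λ ℝ}
  {K : B1Eq324BenfattoLemma.Site d → B1Eq324BenfattoLemma.Site d → ℝ}
  (hK : ∀ x y, K x y = if h : x ∈ Λ ∧ y ∈ Λ then (A⁻¹ : Matrix Λ Λ ℝ) ⟨x, h.1⟩ ⟨y, h.2⟩ else 0)
  {s D : ℕ} {κ : ℝ} {a : Coef d} {J I : Finset (B1Eq324BenfattoLemma.Site d)} {L w v : ℕ} {γ b Ac : ℝ}

include hK

/-- ★★★ **ONE UPPER STEP OF THE CLASS ROAD FROM THE CLASS ROWS, IN THE FRAME `σ`, FOR THE TRANSLATED DATUM AND CONDITIONING SET.**  For the frame-0 class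
member `(Λ, A, K)` (`Λ ≠ ∅`) with its class rows (`A` symmetric `γ_A`-coercive; Euclidean Combes–Thomas row `J_c < γ_A` at rate `θ > 0`; half-rate rows
`V₂`, `M₂`; quarter-rate growth row `V₄`), a frame-0 datum (`A` supported in `J ⊆ I`, `|A| ≤ A_c`, `b ≥ 1`, `0 ≤ γ ≤ 1`), print's pavement (`2(2w+v) < L`,
`v ≤ w`, `L^d e^{−b²/4} ≤ 1/6`), a kernel offset `σ` and a displacement `τ` with the pavement of `B = (J + τ).image boxIndex` inside `Λ − σ` (corridors and
boxes), the definitional part-kernel row of the frame member (parts `shrink L m w`), a conditioning set `C` whose translate `C + τ ⊆ Λ − σ` misses every part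
and is `|·−·|₂`-far (`≥ R`) from every box, and the constant ties of `…ClassUpperStep.exists_upper_step_of_classRows`: THERE ARE per-box exponents `u(□)` with
(hbox) `∫_{χ^□_b}e^{Ψ_□}dN ≤ e^{u(□)}·∫_{χ^□_b}e^{Ψ′₁+Ψ₂}dN` (translated datum `A(·−τ)`, region `I + τ`, `N = 𝒩(u_{(C+τ)∪Γ₁}(ξ), Kb □)` with the conditional
mean of the FRAME kernel `K(·+σ,·+σ)`) for every `□ ∈ B` and every `ξ` `γb`-small on `Γ₁` and `b`-small on `C + τ`, and (hE)
`Σ_□u(□) ≤ cumulantSum μ_{K(·+σ,·+σ)} H^{A(·−τ)}_{J+τ} t − cumulantSum μ_{K(·+σ,·+σ)} H^{A(·−τ)}_{Γ̄₁} t + (Σ_□Err(□) + CUMB)`, errors CLOSED.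
[cite: BenfattoEtAl1978, §5 (5.16)–(5.36) pp.155–159, p.159 «a new pavement displaced», (4.6) p.152; Balaban1985BackgroundPropagators, (1.16)–(1.18) p.180 (class form; ours)] -/
theorem exists_upper_step_of_classRows_frame (hΛ : Λ.Nonempty)
    (hAs : ∀ e e', A e e' = A e' e) {γA : ℝ} (hγA0 : 0 < γA)
    (hγA : ∀ x : Λ → ℝ, γA * ∑ e, x e ^ 2 ≤ ∑ e, ∑ e', A e e' * x e * x e')
    {θ Jc V₂ M₂ V₄ : ℝ} (hθ : 0 < θ)
    (hJc : ∀ e : Λ, ∑ e' : Λ, |A e e'| * (Real.cosh (θ * Real.sqrt (∑ j, ((((e : B1Eq324BenfattoLemma.Site d) j : ℝ) - ((e' : B1Eq324BenfattoLemma.Site d) j : ℝ))) ^ 2)) - 1) ≤ Jc)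
    (hJcγ : Jc < γA)
    (hV₂ : ∀ e : Λ, ∑ e' : Λ, Real.exp (-(θ / 2 * Real.sqrt (∑ j, ((((e : B1Eq324BenfattoLemma.Site d) j : ℝ) - ((e' : B1Eq324BenfattoLemma.Site d) j : ℝ))) ^ 2))) ≤ V₂)
    (hM₂ : ∀ e : Λ, ∑ e' : Λ, |A e e'| * Real.exp (θ / 2 * Real.sqrt (∑ j, ((((e : B1Eq324BenfattoLemma.Site d) j : ℝ) - ((e' : B1Eq324BenfattoLemma.Site d) j : ℝ))) ^ 2)) ≤ M₂)
    (hV₄ : ∀ e : Λ, ∑ e' : Λ, Real.exp (-(θ / 4 * Real.sqrt (∑ j, ((((e : B1Eq324BenfattoLemma.Site d) j : ℝ) - ((e' : B1Eq324BenfattoLemma.Site d) j : ℝ))) ^ 2))) *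
      (1 + Real.sqrt (∑ j, ((((e : B1Eq324BenfattoLemma.Site d) j : ℝ) - ((e' : B1Eq324BenfattoLemma.Site d) j : ℝ))) ^ 2)) ≤ V₄)
    (hκ : 0 < κ) (hJ : CoefSupportedIn a J) (hJI : J ⊆ I) (hAc0 : 0 ≤ Ac)
    (hA : ∀ (p : ℕ) (Δ : Fin p → B1Eq324BenfattoLemma.Site d) (n : Fin p → ℕ), |a p Δ n| ≤ Ac)
    (hL2 : 2 * (2 * w + v) < L) (hv : v ≤ w) (hb : 1 ≤ b) (hγ0 : 0 ≤ γ) (hγ1 : γ ≤ 1)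
    (hsmall : ((L : ℝ) ^ d) * Real.exp (-(b ^ 2 / 4)) ≤ 1 / 6)
    (σ τ : B1Eq324BenfattoLemma.Site d)
    (hΓΛ : corridors L w ((J.image fun x => x + τ).image (boxIndex L)) ⊆ Λ.image fun y => y - σ)
    (hBΛ : ∀ m ∈ ((J.image fun x => x + τ).image (boxIndex L)), box L m ⊆ Λ.image fun y => y - σ)
    {Kb : B1Eq324BenfattoLemma.Site d → B1Eq324BenfattoLemma.Site d → B1Eq324BenfattoLemma.Site d → ℝ}
    (hKb : ∀ m (hm : m ∈ ((J.image fun x => x + τ).image (boxIndex L))) x y, Kb m x y = if h : x ∈ shrink L m w ∧ y ∈ shrink L m w then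
      (((A.submatrix (fun j : ↥(Λ.image fun y => y - σ) => (⟨(j : B1Eq324BenfattoLemma.Site d) + σ, (mem_image_sub_iff σ).mp j.2⟩ : Λ))
          (fun j : ↥(Λ.image fun y => y - σ) => (⟨(j : B1Eq324BenfattoLemma.Site d) + σ, (mem_image_sub_iff σ).mp j.2⟩ : Λ))).submatrix
          (fun j : ↥(shrink L m w) => (⟨j, hBΛ m hm (shrink_subset_box L m w j.2)⟩ : ↥(Λ.image fun y => y - σ)))
          (fun j : ↥(shrink L m w) => (⟨j, hBΛ m hm (shrink_subset_box L m w j.2)⟩ : ↥(Λ.image fun y => y - σ))))⁻¹ :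
          Matrix ↥(shrink L m w) ↥(shrink L m w) ℝ) ⟨x, h.1⟩ ⟨y, h.2⟩ else 0)
    {C : Finset (B1Eq324BenfattoLemma.Site d)} (hCΛ : C.image (fun x => x + τ) ⊆ Λ.image fun y => y - σ)
    (hCsh : ∀ m ∈ ((J.image fun x => x + τ).image (boxIndex L)), Disjoint (shrink L m w) (C.image fun x => x + τ)) {R : ℝ}
    (hCfar : ∀ m ∈ ((J.image fun x => x + τ).image (boxIndex L)), ∀ x ∈ box L m, ∀ c ∈ C.image (fun x => x + τ), R ≤ Real.sqrt (∑ j, (((x j : ℝ) - (c j : ℝ))) ^ 2))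
    {Ku K₀ ε₃₁ : ℝ} (hKuI : (1 + M₂ * V₄ / (γA - Jc) * (γ + 1)) * b ≤ Ku) (hKuK : Ku ≤ K₀) (hK₀ : 1 / (γA - Jc) ≤ K₀) (hK₀1 : 1 ≤ K₀)
    (hε₁ : V₂ * M₂ / (γA - Jc) ^ 2 * Real.exp (-(θ / 2 * ((w - v : ℕ) : ℝ))) + Real.exp (-(θ * ((w - v : ℕ) : ℝ))) / (γA - Jc) ≤ ε₃₁)
    (hε₂ : M₂ * V₄ / (γA - Jc) * (γ * Real.exp (-(θ / 4 * ((w - v : ℕ) : ℝ))) + Real.exp (-(θ / 4 * R))) * b *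
      (1 + Real.sqrt d * ((L : ℝ) - 1)) ≤ ε₃₁)
    (hhalf : 1 / γA ≤ 1 / 2) (hsmallU : M₂ * V₄ / (γA - Jc) * (γ + Real.exp (-(θ / 4 * R))) ≤ 1 / 2)
    {δ : ℝ} (hδ : 0 < δ) (hδle : δ ≤ θ / Real.sqrt d) (hres : 0 < κ / 2 - δ / 2 * ((D : ℝ) ^ 2 * Real.sqrt d)) (t : ℕ) :
    ∃ u : B1Eq324BenfattoLemma.Site d → ℝ,
      (∀ m ∈ ((J.image fun x => x + τ).image (boxIndex L)), ∀ ξ : B1Eq324BenfattoLemma.Site d → ℝ,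
        ξ ∈ smallFieldOn (corridors L w ((J.image fun x => x + τ).image (boxIndex L)) : Set (B1Eq324BenfattoLemma.Site d)) (I.image fun x => x + τ) (γ * b) →
        ξ ∈ smallFieldOn ((C.image fun x => x + τ : Finset (B1Eq324BenfattoLemma.Site d)) : Set (B1Eq324BenfattoLemma.Site d)) (I.image fun x => x + τ) b →
        ∫ z in smallFieldOn (shrink L m w : Set (B1Eq324BenfattoLemma.Site d)) (I.image fun x => x + τ) b,
            Real.exp (psiBox s D κ (shiftCoef a (-τ)) L w m z) ∂((gaussianFieldOfKernel (Kb m)).map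
              fun (ζ : B1Eq324BenfattoLemma.Site d → ℝ) (x : B1Eq324BenfattoLemma.Site d) => condMean (fun x y => K (x + σ) (y + σ)) (C.image (fun x => x + τ) ∪ corridors L w ((J.image fun x => x + τ).image (boxIndex L))) ξ x + ζ x)
          ≤ Real.exp (u m) * ∫ z in smallFieldOn (shrink L m w : Set (B1Eq324BenfattoLemma.Site d)) (I.image fun x => x + τ) b,
            Real.exp (psi1p s D κ (shiftCoef a (-τ)) L w v m z + psi2 s D κ (shiftCoef a (-τ)) L w m z) ∂((gaussianFieldOfKernel (Kb m)).map
              fun (ζ : B1Eq324BenfattoLemma.Site d → ℝ) (x : B1Eq324BenfattoLemma.Site d) => condMean (fun x y => K (x + σ) (y + σ)) (C.image (fun x => x + τ) ∪ corridors L w ((J.image fun x => x + τ).image (boxIndex L))) ξ x + ζ x)) ∧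
      (∑ m ∈ ((J.image fun x => x + τ).image (boxIndex L)), u m ≤
        (cumulantSum (gaussianFieldOfKernel fun x y => K (x + σ) (y + σ)) (hamiltonian s D κ (shiftCoef a (-τ)) (J.image fun x => x + τ)) t - cumulantSum (gaussianFieldOfKernel fun x y => K (x + σ) (y + σ)) (hamiltonian s D κ (shiftCoef a (-τ)) (corridorsBar L w v ((J.image fun x => x + τ).image (boxIndex L)))) t)
          + (∑ m ∈ ((J.image fun x => x + τ).image (boxIndex L)),
              (2 * (2 ^ ((t + 1).choose 2) * (4 * (s1Const s D d κ * Ac * b ^ D * (L : ℝ) ^ d)) ^ (t + 1) / (t + 1)!) +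
                    Real.exp (2 * (4 * (s1Const s D d κ * Ac * b ^ D * (L : ℝ) ^ d))) *
                      (3 * (((shrink L m w).card : ℝ) * Real.exp (-(b ^ 2 / 4)))) +
                    ∑ k ∈ Finset.range t,
                      (3 ^ (k + 1) * ((∑ π ∈ setPartitions (univ : Finset (Fin (k + 1))), ((π.card - 1)! : ℝ)) *
                          (s1Const s D d κ * Ac * b ^ D * Real.exp (-(κ / 4 * v)) * (L : ℝ) ^ d *
                            (4 * (s1Const s D d κ * Ac * b ^ D * (L : ℝ) ^ d)) ^ k)) +
                        3 ^ (k + 1) * (2 ^ (k + 1) * ((∑ π ∈ setPartitions (univ : Finset (Fin (k + 1))), ((π.card - 1)! : ℝ)) *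
                            ((min 1 (2 * ((shrink L m w).card : ℝ) * Real.exp (-(b ^ 2 / 4)))) ^ ((2 * (k + 1) : ℕ) : ℝ)⁻¹ *
                              ((1 + Ku) ^ D * (Ac * (L : ℝ) ^ d * ∑ p ∈ Finset.Icc 1 s, ((admissible p D).card : ℝ) *
              ((2 / (1 - Real.exp (-(κ / 2 / (p : ℕ) / Real.sqrt d))) * Real.exp (κ / 2 / (p : ℕ) / Real.sqrt d)) ^ d) ^ (p - 1)) * momentConst D (2 * (k + 1)) K₀.toNNReal) ^ (k + 1))) +
                          2 ^ ((k + 1) * D) * 2 ^ 2 ^ ((k + 1) * D) * K₀ ^ ((k + 1) * D) * Real.exp (-(δ / 2 * ((v : ℝ) + 1))) *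
                            (Ac * Real.exp (δ / 2 * ((D : ℝ) ^ 2 * d)) * (L : ℝ) ^ d * ∑ p ∈ Finset.Icc 1 s, ((admissible p D).card : ℝ) *
              ((2 / (1 - Real.exp (-((κ / 2 - δ / 2 * ((D : ℝ) ^ 2 * Real.sqrt d)) / (p : ℕ) / Real.sqrt d))) *
                Real.exp ((κ / 2 - δ / 2 * ((D : ℝ) ^ 2 * Real.sqrt d)) / (p : ℕ) / Real.sqrt d)) ^ d) ^ (p - 1)) ^ (k + 1)) +
                        3 ^ (k + 1) * (2 ^ (k + 1) * ((∑ π ∈ setPartitions (univ : Finset (Fin (k + 1))), ((π.card - 1)! : ℝ)) *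
                            ((min 1 (2 * ((shrink L m w).card : ℝ) * Real.exp (-(b ^ 2 / 4)))) ^ ((2 * (k + 1) : ℕ) : ℝ)⁻¹ *
                              ((1 + Ku) ^ D * (Ac * (L : ℝ) ^ d * ∑ p ∈ Finset.Icc 1 s, ((admissible p D).card : ℝ) *
              ((2 / (1 - Real.exp (-(κ / 2 / (p : ℕ) / Real.sqrt d))) * Real.exp (κ / 2 / (p : ℕ) / Real.sqrt d)) ^ d) ^ (p - 1)) * momentConst D (2 * (k + 1)) K₀.toNNReal) ^ (k + 1))) +
                          (Ac * (L : ℝ) ^ d * ∑ p ∈ Finset.Icc 1 s, ((admissible p D).card : ℝ) *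
              ((2 / (1 - Real.exp (-(κ / 2 / (p : ℕ) / Real.sqrt d))) * Real.exp (κ / 2 / (p : ℕ) / Real.sqrt d)) ^ d) ^ (p - 1)) ^ (k + 1) * (2 ^ ((k + 1) * D) * 2 ^ 2 ^ ((k + 1) * D) *
                            ((((k + 1) * D : ℕ) : ℝ) * K₀ ^ ((k + 1) * D) * ε₃₁)))) / (k + 1)!) +
            ∑ k ∈ Finset.range t,
          ((2 ^ (k + 1) * (2 ^ ((k + 1) * D) * 2 ^ 2 ^ ((k + 1) * D) * K₀ ^ ((k + 1) * D)) *
          ((Ac * Real.exp (δ / 2 * ((D : ℝ) ^ 2 * d)) *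
              Real.exp (-((κ / 2 - δ / 2 * ((D : ℝ) ^ 2 * Real.sqrt d)) / 2 * w))) * (J.image fun x => x + τ).card *
            ∑ p ∈ Finset.Icc 1 s, ((admissible p D).card : ℝ) *
              ((2 / (1 - Real.exp (-((κ / 2 - δ / 2 * ((D : ℝ) ^ 2 * Real.sqrt d)) / 2 / (p : ℕ) / Real.sqrt d))) *
                Real.exp ((κ / 2 - δ / 2 * ((D : ℝ) ^ 2 * Real.sqrt d)) / 2 / (p : ℕ) / Real.sqrt d)) ^ d) ^ (p - 1)) *
          (Ac * Real.exp (δ / 2 * ((D : ℝ) ^ 2 * d)) *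
            ((1 : ℝ) * (2 / (1 - Real.exp (-(δ / (2 * ((k + 1 : ℕ) : ℝ)) / Real.sqrt d))) * Real.exp (δ / (2 * ((k + 1 : ℕ) : ℝ)) / Real.sqrt d)) ^ d) *
            ∑ p ∈ Finset.Icc 1 s, ((admissible p D).card : ℝ) *
              ((2 / (1 - Real.exp (-((κ / 2 - δ / 2 * ((D : ℝ) ^ 2 * Real.sqrt d)) / (p : ℕ) / Real.sqrt d))) *
                Real.exp ((κ / 2 - δ / 2 * ((D : ℝ) ^ 2 * Real.sqrt d)) / (p : ℕ) / Real.sqrt d)) ^ d) ^ (p - 1)) ^ k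
          + 2 ^ (k + 1) * (2 ^ ((k + 1) * D) * 2 ^ 2 ^ ((k + 1) * D) * K₀ ^ ((k + 1) * D)) *
        (((J.image fun x => x + τ).image (boxIndex L)).card * (Ac * Real.exp (δ / 2 * ((D : ℝ) ^ 2 * d)) * Real.exp (-((κ / 2 - δ / 2 * ((D : ℝ) ^ 2 * Real.sqrt d)) / 2 * v)) *
          (L : ℝ) ^ d * ∑ p ∈ Finset.Icc 1 s, ((admissible p D).card : ℝ) *
              ((2 / (1 - Real.exp (-((κ / 2 - δ / 2 * ((D : ℝ) ^ 2 * Real.sqrt d)) / 2 / (p : ℕ) / Real.sqrt d))) *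
                Real.exp ((κ / 2 - δ / 2 * ((D : ℝ) ^ 2 * Real.sqrt d)) / 2 / (p : ℕ) / Real.sqrt d)) ^ d) ^ (p - 1))) *
        (Ac * Real.exp (δ / 2 * ((D : ℝ) ^ 2 * d)) *
          (2 / (1 - Real.exp (-(δ / (2 * ((k + 1 : ℕ) : ℝ)) / Real.sqrt d))) * Real.exp (δ / (2 * ((k + 1 : ℕ) : ℝ)) / Real.sqrt d)) ^ d *
          ∑ p ∈ Finset.Icc 1 s, ((admissible p D).card : ℝ) *
              ((2 / (1 - Real.exp (-((κ / 2 - δ / 2 * ((D : ℝ) ^ 2 * Real.sqrt d)) / (p : ℕ) / Real.sqrt d))) *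
                Real.exp ((κ / 2 - δ / 2 * ((D : ℝ) ^ 2 * Real.sqrt d)) / (p : ℕ) / Real.sqrt d)) ^ d) ^ (p - 1)) ^ k)
          + (2 ^ (k + 1) * (2 ^ ((k + 1) * D) * 2 ^ 2 ^ ((k + 1) * D) * K₀ ^ ((k + 1) * D)) *
          (Ac * Real.exp (δ / 2 * ((D : ℝ) ^ 2 * d)) * Real.exp (-((κ / 2 - δ / 2 * ((D : ℝ) ^ 2 * Real.sqrt d)) / 2 * w)) *
            (corridorsBar L w v ((J.image fun x => x + τ).image (boxIndex L))).card * ∑ p ∈ Finset.Icc 1 s, ((admissible p D).card : ℝ) *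
              ((2 / (1 - Real.exp (-((κ / 2 - δ / 2 * ((D : ℝ) ^ 2 * Real.sqrt d)) / 2 / (p : ℕ) / Real.sqrt d))) *
                Real.exp ((κ / 2 - δ / 2 * ((D : ℝ) ^ 2 * Real.sqrt d)) / 2 / (p : ℕ) / Real.sqrt d)) ^ d) ^ (p - 1)) *
          (Ac * Real.exp (δ / 2 * ((D : ℝ) ^ 2 * d)) *
            (2 / (1 - Real.exp (-(δ / (2 * ((k + 1 : ℕ) : ℝ)) / Real.sqrt d))) * Real.exp (δ / (2 * ((k + 1 : ℕ) : ℝ)) / Real.sqrt d)) ^ d *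
            ∑ p ∈ Finset.Icc 1 s, ((admissible p D).card : ℝ) *
              ((2 / (1 - Real.exp (-((κ / 2 - δ / 2 * ((D : ℝ) ^ 2 * Real.sqrt d)) / (p : ℕ) / Real.sqrt d))) *
                Real.exp ((κ / 2 - δ / 2 * ((D : ℝ) ^ 2 * Real.sqrt d)) / (p : ℕ) / Real.sqrt d)) ^ d) ^ (p - 1)) ^ k
          + 2 ^ (k + 1) * (2 ^ ((k + 1) * D) * 2 ^ 2 ^ ((k + 1) * D) * K₀ ^ ((k + 1) * D)) *
        (((J.image fun x => x + τ).image (boxIndex L)).card * (Ac * Real.exp (δ / 2 * ((D : ℝ) ^ 2 * d)) * Real.exp (-((κ / 2 - δ / 2 * ((D : ℝ) ^ 2 * Real.sqrt d)) / 2 * v)) *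
          (L : ℝ) ^ d * ∑ p ∈ Finset.Icc 1 s, ((admissible p D).card : ℝ) *
              ((2 / (1 - Real.exp (-((κ / 2 - δ / 2 * ((D : ℝ) ^ 2 * Real.sqrt d)) / 2 / (p : ℕ) / Real.sqrt d))) *
                Real.exp ((κ / 2 - δ / 2 * ((D : ℝ) ^ 2 * Real.sqrt d)) / 2 / (p : ℕ) / Real.sqrt d)) ^ d) ^ (p - 1))) *
        (Ac * Real.exp (δ / 2 * ((D : ℝ) ^ 2 * d)) *
          (2 / (1 - Real.exp (-(δ / (2 * ((k + 1 : ℕ) : ℝ)) / Real.sqrt d))) * Real.exp (δ / (2 * ((k + 1 : ℕ) : ℝ)) / Real.sqrt d)) ^ d *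
          ∑ p ∈ Finset.Icc 1 s, ((admissible p D).card : ℝ) *
              ((2 / (1 - Real.exp (-((κ / 2 - δ / 2 * ((D : ℝ) ^ 2 * Real.sqrt d)) / (p : ℕ) / Real.sqrt d))) *
                Real.exp ((κ / 2 - δ / 2 * ((D : ℝ) ^ 2 * Real.sqrt d)) / (p : ℕ) / Real.sqrt d)) ^ d) ^ (p - 1)) ^ k)
          + 2 ^ ((k + 1) * D) * 2 ^ 2 ^ ((k + 1) * D) * K₀ ^ ((k + 1) * D) *
        (((J.image fun x => x + τ).image (boxIndex L)).card * (((k + 1 : ℕ) : ℝ) * (k : ℝ) *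
          ((Ac * Real.exp (δ / 2 * ((D : ℝ) ^ 2 * d)) * ((L : ℝ) ^ d * (2 / (1 - Real.exp (-(δ / (2 * ((k + 1 : ℕ) : ℝ)) / Real.sqrt d))) * Real.exp (δ / (2 * ((k + 1 : ℕ) : ℝ)) / Real.sqrt d)) ^ d) *
              ∑ p ∈ Finset.Icc 1 s, ((admissible p D).card : ℝ) *
              ((2 / (1 - Real.exp (-((κ / 2 - δ / 2 * ((D : ℝ) ^ 2 * Real.sqrt d)) / (p : ℕ) / Real.sqrt d))) *
                Real.exp ((κ / 2 - δ / 2 * ((D : ℝ) ^ 2 * Real.sqrt d)) / (p : ℕ) / Real.sqrt d)) ^ d) ^ (p - 1)) * ((Ac * Real.exp (δ / 2 * ((D : ℝ) ^ 2 * d)) * Real.exp (-(δ / (2 * ((k + 1 : ℕ) : ℝ)) / 2 * ((w : ℝ) + v + 1))) * ((L : ℝ) ^ d * (2 / (1 - Real.exp (-(δ / (2 * ((k + 1 : ℕ) : ℝ)) / 2 / Real.sqrt d))) * Real.exp (δ / (2 * ((k + 1 : ℕ) : ℝ)) / 2 / Real.sqrt d)) ^ d) *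
              ∑ p ∈ Finset.Icc 1 s, ((admissible p D).card : ℝ) *
              ((2 / (1 - Real.exp (-((κ / 2 - δ / 2 * ((D : ℝ) ^ 2 * Real.sqrt d)) / (p : ℕ) / Real.sqrt d))) *
                Real.exp ((κ / 2 - δ / 2 * ((D : ℝ) ^ 2 * Real.sqrt d)) / (p : ℕ) / Real.sqrt d)) ^ d) ^ (p - 1)) *
             (Ac * Real.exp (δ / 2 * ((D : ℝ) ^ 2 * d)) * ((L : ℝ) ^ d * (2 / (1 - Real.exp (-(δ / (2 * ((k + 1 : ℕ) : ℝ)) / Real.sqrt d))) * Real.exp (δ / (2 * ((k + 1 : ℕ) : ℝ)) / Real.sqrt d)) ^ d) *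
              ∑ p ∈ Finset.Icc 1 s, ((admissible p D).card : ℝ) *
              ((2 / (1 - Real.exp (-((κ / 2 - δ / 2 * ((D : ℝ) ^ 2 * Real.sqrt d)) / (p : ℕ) / Real.sqrt d))) *
                Real.exp ((κ / 2 - δ / 2 * ((D : ℝ) ^ 2 * Real.sqrt d)) / (p : ℕ) / Real.sqrt d)) ^ d) ^ (p - 1)) ^ (k - 1)))))
          + ((J.image fun x => x + τ).image (boxIndex L)).card * ((3 : ℝ) ^ (k + 1) *
        (2 ^ ((k + 1) * D) * 2 ^ 2 ^ ((k + 1) * D) * K₀ ^ ((k + 1) * D) *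
            Real.exp (-(δ / 2 * ((v : ℝ) + 1))) *
          (Ac * Real.exp (δ / 2 * ((D : ℝ) ^ 2 * d)) * (L : ℝ) ^ d * ∑ p ∈ Finset.Icc 1 s, ((admissible p D).card : ℝ) *
              ((2 / (1 - Real.exp (-((κ / 2 - δ / 2 * ((D : ℝ) ^ 2 * Real.sqrt d)) / (p : ℕ) / Real.sqrt d))) *
                Real.exp ((κ / 2 - δ / 2 * ((D : ℝ) ^ 2 * Real.sqrt d)) / (p : ℕ) / Real.sqrt d)) ^ d) ^ (p - 1)) ^ (k + 1)))) / (k + 1)!)) := by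
  classical
  -- the class member in frame `σ`: the class rows are frame invariant
  have hKσ := kernel_translate σ hK
  have hAsσ := submatrix_translate_symm σ hAs
  have hγAσ := submatrix_translate_coercive σ hγA
  have hl2 : ∀ x y : B1Eq324BenfattoLemma.Site d, Real.sqrt (∑ j, ((((x + σ) j : ℝ) - ((y + σ) j : ℝ))) ^ 2) = Real.sqrt (∑ j, (((x j : ℝ) - (y j : ℝ))) ^ 2) :=
    fun x y => l2_translate x y σ
  have hJcσ := submatrix_translate_row_le σ (A := A)
    (fun x y : B1Eq324BenfattoLemma.Site d => Real.cosh (θ * Real.sqrt (∑ j, (((x j : ℝ) - (y j : ℝ))) ^ 2)) - 1) (fun x y => by simp only [hl2]) hJc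
  have hV₂σ := translate_row_le σ (Λ := Λ)
    (fun x y : B1Eq324BenfattoLemma.Site d => Real.exp (-(θ / 2 * Real.sqrt (∑ j, (((x j : ℝ) - (y j : ℝ))) ^ 2)))) (fun x y => by simp only [hl2]) hV₂
  have hM₂σ := submatrix_translate_row_le σ (A := A)
    (fun x y : B1Eq324BenfattoLemma.Site d => Real.exp (θ / 2 * Real.sqrt (∑ j, (((x j : ℝ) - (y j : ℝ))) ^ 2))) (fun x y => by simp only [hl2]) hM₂
  have hV₄σ := translate_row_le σ (Λ := Λ)
    (fun x y : B1Eq324BenfattoLemma.Site d => Real.exp (-(θ / 4 * Real.sqrt (∑ j, (((x j : ℝ) - (y j : ℝ))) ^ 2))) *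
      (1 + Real.sqrt (∑ j, (((x j : ℝ) - (y j : ℝ))) ^ 2))) (fun x y => by simp only [hl2]) hV₄
  have hΛσ : (Λ.image fun y => y - σ).Nonempty := hΛ.image _
  -- the standard-position upper step at the frame member, for the translated datum and the translated conditioning set
  exact exists_upper_step_of_classRows hKσ hBΛ hKb hΛσ hAsσ hγA0 hγAσ hθ hJcσ hJcγ hV₂σ hM₂σ hV₄σ hκ
    (coefSupportedIn_frame hJ τ) (Finset.image_subset_image hJI) hAc0 (fun p Δ n => abs_shiftCoef_neg_le hA τ p Δ n) hL2 hv hb hγ0 hγ1 hsmall hΓΛ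
    hCΛ hCsh hCfar hKuI hKuK hK₀ hK₀1 hε₁ hε₂ hhalf hsmallU hδ hδle hres t (s := s) (D := D)

end Frame

end Literature.MathematicalPhysics.QuantumFieldTheory.Balaban1983to89.B1Eq324BenfattoKernelSect5ClassUpperStepFrame

end
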